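import Literature.Probability.FitznerVanDerHofstad2017.SrwChatPowSchwinger
import Literature.Probability.FitznerVanDerHofstad2017.SrwAbsCosineDefect
import Mathlib.RingTheory.RootsOfUnity.Complex
import HarnessLib

/-!
# Two cosine insertions in the one-coordinate factorisation — the `l = 2` axis atoms `K_{n+1,2}(m e_i)`

d-generic identities (every `d` in the stated ranges; no numerical content), extending the `l = 0`
axis-atom reduction of `SrwChatPowSchwinger` (Part II) / `SrwAxisAtomDoubleIntegral` to the EVEN
weight `|D̂|² = D̂²` WITHOUT differentiating under the integral: expand
`(d·D̂(k))² = (Σ_j cos k_j)² = Σ_a Σ_b cos k_a cos k_b` and factorise coordinate-wise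
(`MeasureTheory.integral_fintype_prod_eq_prod`) with at most two cosine insertions:

* `integral_sum_cos_sq_mul_cexp_P` —
  `∫ (Σ_j cos k_j)² e^{τD̂(k) + iβ Σ_j cos(m k_j)} dk = d·C₂·B^{d-1} + d(d-1)·C₁²·B^{d-2}`,
  `B = ∫ E`, `C₁ = ∫ cos·E`, `C₂ = ∫ cos²·E`, `E(t) = e^{(τ/d) cos t + iβ cos(m t)}` over `[-π,π]`;
* `integral_Dhat_sq_mul_one_sub_cos_mul_exp_schwinger_single` — the cosine-defect / Schwinger
  inner integral with weight `D̂²`: `e^{-τ} d^{-2} · Re (F(τ,0) - F(τ,β))`, `F` = the right-hand side above;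
* `srwK_succ_two_single_eq_integral_axisTransform` — the atom
  `K_{n+1,2}(m e_i) = (2/(πd)) ∫₀^∞ β^{-2} [(n!)^{-1} ∫₀^∞ τⁿ e^{-τ} d^{-2} Re (F(τ,0) - F(τ,β)) dτ] /(2π)^d dβ`
  for `d ≥ 2n + 3` (composition with `srwK_eq_integral_cosDefect_scaled`, `l = 2`);
* `integral_Dhat_sq_mul_one_sub_cos_single`, `srwK_zero_two_single_eq_integral` — the `τ = 0`
  slice (no Schwinger weight) and `K_{0,2}(m e_i)` as a single `β`-integral, `d ≥ 2`;
* `integral_cexp_mul_cos_int_mul_μI` — the `τ = 0` twisted zeroth factor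
  `∫ e^{iβ cos(m t)} dμI = 2π J₀(β)` for every integer `m ≠ 0` (full-period dilation).
* shift-averaging over roots of unity (section `ShiftAverage`):
  `intervalIntegral_cos_mul_mul_comp_natCast_mul_eq_zero` — `∫_{-π}^{π} cos(k t)·g(n t) dt = 0` for
  continuous `2π`-periodic `g` whenever `n ∤ k` (and the case `k = 1`, `n ≥ 2`); hence the `τ = 0`
  twisted factors `C₁(0,β) = 0` for `|m| ≥ 2` (`integral_cos_mul_cexp_mul_cos_int_mul_μI_eq_zero`)
  and `C₂(0,β) = ½ B(0,β)` for `|m| ≥ 3` (`integral_cos_sq_mul_cexp_mul_cos_int_mul_μI`);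
* the `|m| ∈ {1, 2}` twisted factors via `J₁` (section `JOne`):
  `hasDerivAt_integral_cexp_mul_cos_μI` (dominated differentiation of `β ↦ ∫ e^{iβ cos t} dμI`),
  `integral_cos_mul_cexp_mul_cos_μI` — `∫ cos t · e^{iβ cos t} dμI = 2πi J₁(β)` (`J₀' = -J₁`,
  `hasDerivAt_besselJ_zero_holds`, uniqueness of the derivative), and
  `integral_cos_sq_mul_cexp_mul_cos_two_mul_μI` — `∫ cos² t · e^{iβ cos 2t} dμI = πJ₀(β) + πiJ₁(β)`;
* **`srwK_zero_two_single_eq_kappa_div`** — the closed form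
  `K_{0,2}(m e_i) = K_{0,0}(e_i) / (2d) = κ_d / (2d)` for every `d ≥ 2` and every `|m| ≥ 2`
  (untwisted bracket `(d/2)(2π)^d`; twisted bracket `(d/2)(2πJ₀(β))^d` for `|m| ≥ 3`, and
  real part `(d/2)(2πJ₀(β))^d` for `|m| = 2`; then `srwK_zero_zero_single_eq_integral_besselJ`);
  cases `srwK_zero_two_single_eq_kappa_div_of_three_le`, `…_of_abs_eq_two`.
* the `|m| = 1` case (`D̂^{(e_i)} = D̂`): `integral_sin_sq_mul_cexp_mul_cos_μI`
  (`∫ sin² t · e^{iβ cos t} dμI = 2πJ₁(β)/β`, integration by parts), `integral_cos_sq_mul_cexp_mul_cos_μI`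
  (`C₂(0,β)|_{m=1} = 2πJ₀(β) - 2πJ₁(β)/β`), and **`srwK_zero_two_single_one_eq_integral_besselJ`** —
  `K_{0,2}(e_i) = ∫ D̂²|D̂| = (2/(πd)) ∫₀^∞ β⁻² (1/d)[½ - J₀^d + J₁J₀^{d-1}/β + (d-1)J₁²J₀^{d-2}] dβ`
  for every `d ≥ 2`.  Together with the `|m| ≥ 2` closed form this puts every `K_{0,2}(m e_i)`,
  `m ≠ 0`, in explicit one-dimensional Bessel form.

Sources: DLMF 10.9.2, 10.6.3 (Bessel's integral, `J₀' = -J₁`); Fitzner–van der Hofstad, *Mean-field behavior for nearest-neighbor percolation in d > 10*,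
§5.1.1 (5.2)–(5.4) (Bessel / one-coordinate representation of the SRW integrals) and (3.34)–(3.36)
p. 1071 (the `K_{n,l}` family).
-/

noncomputable section

open MeasureTheory Set Filter Real Finset
open scoped Topology Nat

namespace Literature.Probability.FitznerVanDerHofstad2017

open Literature.Barriers.CriticalPhenomena
open Literature.Barriers.CriticalPhenomena.Slade2006Prop53 (μI P)

variable {d : ℕ}

/-- **Two-cosine-insertion twisted factorisation** (`l = 2` analogue of `integral_cexp_mul_Dhat_add_P`):
`∫ (Σ_j cos k_j)² e^{τD̂(k) + iβ Σ_j cos(m k_j)} dk = d·C₂·B^{d-1} + d(d-1)·C₁²·B^{d-2}` for `d ≥ 2`.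
[cite: FitznerVanDerHofstad2016NoBLE, §5.1.1 (5.2)–(5.4)] -/
theorem integral_sum_cos_sq_mul_cexp_P (hd : 2 ≤ d) (τ β : ℝ) (m : ℤ) :
    ∫ k, ((((∑ j, Real.cos (k j)) ^ 2 : ℝ)) : ℂ)
        * Complex.exp (((τ * Dhat d k : ℝ) : ℂ) + ((β * ∑ j, Real.cos (m * k j) : ℝ) : ℂ) * Complex.I) ∂P d
      = (d : ℂ) * (∫ t, ((Real.cos t ^ 2 : ℝ) : ℂ)
              * Complex.exp (((τ / d * Real.cos t : ℝ) : ℂ) + ((β * Real.cos (m * t) : ℝ) : ℂ) * Complex.I) ∂μI)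
          * (∫ t, Complex.exp (((τ / d * Real.cos t : ℝ) : ℂ) + ((β * Real.cos (m * t) : ℝ) : ℂ) * Complex.I) ∂μI) ^ (d - 1)
        + (d : ℂ) * ((d : ℂ) - 1)
          * (∫ t, ((Real.cos t : ℝ) : ℂ)
              * Complex.exp (((τ / d * Real.cos t : ℝ) : ℂ) + ((β * Real.cos (m * t) : ℝ) : ℂ) * Complex.I) ∂μI) ^ 2
          * (∫ t, Complex.exp (((τ / d * Real.cos t : ℝ) : ℂ) + ((β * Real.cos (m * t) : ℝ) : ℂ) * Complex.I) ∂μI) ^ (d - 2) := by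
  -- the one-coordinate factor and its cosine insertions
  set E : ℝ → ℂ := fun t =>
    Complex.exp (((τ / d * Real.cos t : ℝ) : ℂ) + ((β * Real.cos (m * t) : ℝ) : ℂ) * Complex.I) with hEdef
  set B : ℂ := ∫ t, E t ∂μI with hB
  set C1 : ℂ := ∫ t, ((Real.cos t : ℝ) : ℂ) * E t ∂μI with hC1
  set C2 : ℂ := ∫ t, ((Real.cos t ^ 2 : ℝ) : ℂ) * E t ∂μI with hC2
  have hd0 : (d : ℝ) ≠ 0 := by exact_mod_cast (show d ≠ 0 by omega)
  have hE : Continuous E := by rw [hEdef]; fun_prop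
  -- exp of the sum = product of the factors
  have hprod : ∀ k : Fin d → ℝ,
      Complex.exp (((τ * Dhat d k : ℝ) : ℂ) + ((β * ∑ j, Real.cos (m * k j) : ℝ) : ℂ) * Complex.I)
        = ∏ j, E (k j) := by
    intro k
    have hτ : τ * Dhat d k = ∑ j, τ / d * Real.cos (k j) := by
      simp only [Dhat, Finset.sum_div, Finset.mul_sum]
      exact Finset.sum_congr rfl fun j _ => by field_simp
    rw [hEdef, ← Complex.exp_sum, hτ, Finset.mul_sum]
    push_cast
    rw [Finset.sum_mul, ← Finset.sum_add_distrib]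
  -- insertion factors
  set F : Fin d → Fin d → Fin d → ℝ → ℂ := fun a b j t =>
    (if j = a then ((Real.cos t : ℝ) : ℂ) else 1) * ((if j = b then ((Real.cos t : ℝ) : ℂ) else 1) * E t) with hF
  have hFprod : ∀ (a b : Fin d) (k : Fin d → ℝ),
      ∏ j, F a b j (k j) = ((Real.cos (k a) : ℝ) : ℂ) * (((Real.cos (k b) : ℝ) : ℂ) * ∏ j, E (k j)) := by
    intro a b k
    simp only [hF, Finset.prod_mul_distrib, Finset.prod_ite_eq', Finset.mem_univ, if_true]
  -- pointwise: the integrand is the double sum of the insertion products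
  have hpt : ∀ k : Fin d → ℝ,
      ((((∑ j, Real.cos (k j)) ^ 2 : ℝ)) : ℂ)
        * Complex.exp (((τ * Dhat d k : ℝ) : ℂ) + ((β * ∑ j, Real.cos (m * k j) : ℝ) : ℂ) * Complex.I)
        = ∑ a, ∑ b, ∏ j, F a b j (k j) := by
    intro k
    rw [hprod k, sq, Complex.ofReal_mul, Complex.ofReal_sum, Finset.sum_mul_sum, Finset.sum_mul]
    refine Finset.sum_congr rfl fun a _ => ?_
    rw [Finset.sum_mul]
    refine Finset.sum_congr rfl fun b _ => ?_
    rw [hFprod]; ring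
  simp_rw [hpt]
  -- integrability of each product (bounded continuous on a finite measure)
  have hite : ∀ a j : Fin d, Continuous (fun t : ℝ => if j = a then ((Real.cos t : ℝ) : ℂ) else (1 : ℂ)) := by
    intro a j
    by_cases h : j = a
    · simp only [h, if_true]; fun_prop
    · simp only [h, if_false]; fun_prop
  have hFcont : ∀ a b j, Continuous (F a b j) := fun a b j => by
    simp only [hF]; exact (hite a j).mul ((hite b j).mul hE)
  have hInt : ∀ a b, Integrable (fun k : Fin d → ℝ => ∏ j, F a b j (k j)) (P d) := by
    intro a b
    have hc : Continuous (fun k : Fin d → ℝ => ∏ j, F a b j (k j)) :=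
      continuous_finsetProd _ fun j _ => (hFcont a b j).comp (continuous_apply j)
    -- bound: |cos| ≤ 1 and ‖E t‖ = e^{(τ/d) cos t} ≤ e^{|τ/d|}
    have hEn : ∀ t, ‖E t‖ ≤ Real.exp |τ / d| := by
      intro t
      rw [hEdef]
      simp only [Complex.norm_exp, Complex.add_re, Complex.ofReal_re, Complex.mul_re, Complex.I_re,
        Complex.I_im, Complex.ofReal_im, mul_zero, mul_one, sub_zero, add_zero]
      exact Real.exp_le_exp.2 ((le_abs_self _).trans (by
        rw [abs_mul]; exact mul_le_of_le_one_right (abs_nonneg _) (abs_cos_le_one _)))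
    have hFn : ∀ j t, ‖F a b j t‖ ≤ Real.exp |τ / d| := by
      intro j t
      have h1 : ‖(if j = a then ((Real.cos t : ℝ) : ℂ) else 1)‖ ≤ 1 := by
        split_ifs
        · rw [Complex.norm_real]; exact abs_cos_le_one t
        · simp
      have h2 : ‖(if j = b then ((Real.cos t : ℝ) : ℂ) else 1)‖ ≤ 1 := by
        split_ifs
        · rw [Complex.norm_real]; exact abs_cos_le_one t
        · simp
      simp only [hF, norm_mul]
      calc _ ≤ 1 * (1 * Real.exp |τ / d|) := by
            gcongr
            exact hEn t
        _ = Real.exp |τ / d| := by ring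
    refine (integrable_const ((Real.exp |τ / d|) ^ d)).mono' hc.aestronglyMeasurable (ae_of_all _ fun k => ?_)
    calc ‖∏ j, F a b j (k j)‖ = ∏ j, ‖F a b j (k j)‖ := norm_prod _ _
      _ ≤ ∏ _j : Fin d, Real.exp |τ / d| := Finset.prod_le_prod (fun j _ => norm_nonneg _) fun j _ => hFn j (k j)
      _ = Real.exp |τ / d| ^ d := by rw [Finset.prod_const, Finset.card_univ, Fintype.card_fin]
  rw [integral_finsetSum _ fun a _ => integrable_finsetSum _ fun b _ => hInt a b]
  simp_rw [integral_finsetSum _ fun b _ => hInt _ b]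
  -- each term factorises
  have hfac : ∀ a b, ∫ k, ∏ j, F a b j (k j) ∂P d = ∏ j, ∫ t, F a b j t ∂μI := by
    intro a b
    rw [show P d = Measure.pi (fun _ : Fin d => μI) from rfl, integral_fintype_prod_eq_prod (𝕜 := ℂ) (F a b)]
  simp_rw [hfac]
  -- the one-dimensional integrals
  have hI : ∀ a b j, ∫ t, F a b j t ∂μI
      = if j = a then (if j = b then C2 else C1) else (if j = b then C1 else B) := by
    intro a b j
    have hptF : ∀ t, F a b j t
        = if j = a then (if j = b then ((Real.cos t ^ 2 : ℝ) : ℂ) * E t else ((Real.cos t : ℝ) : ℂ) * E t)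
          else (if j = b then ((Real.cos t : ℝ) : ℂ) * E t else E t) := by
      intro t; simp only [hF]; split_ifs <;> push_cast <;> ring
    simp_rw [hptF]
    split_ifs <;> rfl
  simp_rw [hI]
  -- the product over `j`
  have hP : ∀ a b : Fin d,
      ∏ j, (if j = a then (if j = b then C2 else C1) else (if j = b then C1 else B))
        = if a = b then C2 * B ^ (d - 1) else C1 * C1 * B ^ (d - 2) := by
    intro a b
    by_cases hab : a = b
    · subst hab
      rw [← Finset.mul_prod_erase _ _ (Finset.mem_univ a)]
      simp only [if_true]
      congr 1
      rw [Finset.prod_congr rfl (g := fun _ => B) (fun j hj => by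
            rw [if_neg (Finset.ne_of_mem_erase hj), if_neg (Finset.ne_of_mem_erase hj)]),
        Finset.prod_const, Finset.card_erase_of_mem (Finset.mem_univ a), Finset.card_univ,
        Fintype.card_fin]
    · have hbm : b ∈ Finset.univ.erase a := Finset.mem_erase.2 ⟨Ne.symm hab, Finset.mem_univ b⟩
      rw [← Finset.mul_prod_erase _ _ (Finset.mem_univ a), ← Finset.mul_prod_erase _ _ hbm]
      simp only [if_true, if_false, hab, Ne.symm hab]
      rw [Finset.prod_congr rfl (g := fun _ => B) (fun j hj => by
            rw [if_neg (Finset.ne_of_mem_erase (Finset.mem_of_mem_erase hj)),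
              if_neg (Finset.ne_of_mem_erase hj)]),
        Finset.prod_const, Finset.card_erase_of_mem hbm, Finset.card_erase_of_mem (Finset.mem_univ a),
        Finset.card_univ, Fintype.card_fin, Nat.sub_sub]
      ring
  simp_rw [hP]
  -- the sum over `a, b`
  have hS : ∀ a : Fin d, ∑ b, (if a = b then C2 * B ^ (d - 1) else C1 * C1 * B ^ (d - 2))
      = C2 * B ^ (d - 1) + ((d : ℂ) - 1) * (C1 * C1 * B ^ (d - 2)) := by
    intro a
    rw [← Finset.add_sum_erase _ _ (Finset.mem_univ a)]
    simp only [if_true]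
    congr 1
    rw [Finset.sum_congr rfl (g := fun _ => C1 * C1 * B ^ (d - 2)) (fun b hb => by
          rw [if_neg (fun h => Finset.ne_of_mem_erase hb h.symm)]),
      Finset.sum_const, Finset.card_erase_of_mem (Finset.mem_univ a), Finset.card_univ,
      Fintype.card_fin, nsmul_eq_mul, Nat.cast_sub (by omega : 1 ≤ d), Nat.cast_one]
  simp_rw [hS]
  rw [Finset.sum_const, Finset.card_univ, Fintype.card_fin, nsmul_eq_mul]
  ring

/-- Integrability of the two-insertion twisted integrand (bounded continuous on a finite measure). [folklore] -/
private theorem integrable_sum_cos_sq_mul_cexp (τ β : ℝ) (m : ℤ) :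
    Integrable (fun k : Fin d → ℝ => ((((∑ j, Real.cos (k j)) ^ 2 : ℝ)) : ℂ)
        * Complex.exp (((τ * Dhat d k : ℝ) : ℂ) + ((β * ∑ j, Real.cos (m * k j) : ℝ) : ℂ) * Complex.I)) (P d) := by
  have hD := continuous_Dhat d
  have hc : Continuous (fun k : Fin d → ℝ => ((((∑ j, Real.cos (k j)) ^ 2 : ℝ)) : ℂ)
        * Complex.exp (((τ * Dhat d k : ℝ) : ℂ) + ((β * ∑ j, Real.cos (m * k j) : ℝ) : ℂ) * Complex.I)) := by
    fun_prop
  refine (integrable_const (((d : ℝ)) ^ 2 * Real.exp |τ|)).mono' hc.aestronglyMeasurable (ae_of_all _ fun k => ?_)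
  rw [norm_mul, Complex.norm_real, Complex.norm_exp, Complex.add_re, Complex.ofReal_re, Complex.re_ofReal_mul,
    Complex.I_re, mul_zero, add_zero, Real.norm_eq_abs, abs_pow]
  have h1 : |∑ j, Real.cos (k j)| ≤ d := by
    calc |∑ j, Real.cos (k j)| ≤ ∑ j, |Real.cos (k j)| := Finset.abs_sum_le_sum_abs _ _
      _ ≤ ∑ _j : Fin d, (1:ℝ) := Finset.sum_le_sum fun j _ => Real.abs_cos_le_one _
      _ = d := by simp
  have h2 : Real.exp (τ * Dhat d k) ≤ Real.exp |τ| :=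
    Real.exp_le_exp.2 ((le_abs_self _).trans (by
      rw [abs_mul]; exact mul_le_of_le_one_right (abs_nonneg _) (abs_Dhat_le_one k)))
  exact mul_le_mul (pow_le_pow_left₀ (abs_nonneg _) h1 2) h2 (Real.exp_pos _).le (by positivity)

/-- Real part of the two-insertion factorisation:
`∫ (Σ_j cos k_j)² e^{τD̂(k)} cos(β Σ_j cos(m k_j)) dk = Re (d·C₂·B^{d-1} + d(d-1)·C₁²·B^{d-2})`.
[cite: FitznerVanDerHofstad2016NoBLE, §5.1.1 (5.2)–(5.4)] -/
theorem integral_sum_cos_sq_mul_exp_mul_cos_P (hd : 2 ≤ d) (τ β : ℝ) (m : ℤ) :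
    ∫ k, (∑ j, Real.cos (k j)) ^ 2 * (Real.exp (τ * Dhat d k) * Real.cos (β * ∑ j, Real.cos (m * k j))) ∂P d
      = ((d : ℂ) * (∫ t, ((Real.cos t ^ 2 : ℝ) : ℂ)
              * Complex.exp (((τ / d * Real.cos t : ℝ) : ℂ) + ((β * Real.cos (m * t) : ℝ) : ℂ) * Complex.I) ∂μI)
          * (∫ t, Complex.exp (((τ / d * Real.cos t : ℝ) : ℂ) + ((β * Real.cos (m * t) : ℝ) : ℂ) * Complex.I) ∂μI) ^ (d - 1)
        + (d : ℂ) * ((d : ℂ) - 1)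
          * (∫ t, ((Real.cos t : ℝ) : ℂ)
              * Complex.exp (((τ / d * Real.cos t : ℝ) : ℂ) + ((β * Real.cos (m * t) : ℝ) : ℂ) * Complex.I) ∂μI) ^ 2
          * (∫ t, Complex.exp (((τ / d * Real.cos t : ℝ) : ℂ) + ((β * Real.cos (m * t) : ℝ) : ℂ) * Complex.I) ∂μI) ^ (d - 2)).re := by
  have h2 : (fun k : Fin d → ℝ => (∑ j, Real.cos (k j)) ^ 2 * (Real.exp (τ * Dhat d k) * Real.cos (β * ∑ j, Real.cos (m * k j))))
      = fun k => RCLike.re (((((∑ j, Real.cos (k j)) ^ 2 : ℝ)) : ℂ) * Complex.exp (((τ * Dhat d k : ℝ) : ℂ)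
          + ((β * ∑ j, Real.cos (m * k j) : ℝ) : ℂ) * Complex.I)) := by
    funext k
    rw [RCLike.re_to_complex, Complex.re_ofReal_mul, Complex.exp_re, Complex.add_re, Complex.ofReal_re,
      Complex.re_ofReal_mul, Complex.I_re, mul_zero, add_zero, Complex.add_im, Complex.ofReal_im,
      Complex.im_ofReal_mul, Complex.I_im, mul_one, zero_add]
  rw [h2, integral_re (integrable_sum_cos_sq_mul_cexp τ β m), integral_sum_cos_sq_mul_cexp_P hd,
    RCLike.re_to_complex]

/-- The untwisted (`β = 0`) case: `∫ (Σ_j cos k_j)² e^{τD̂(k)} dk = Re (d·C₂⁰·B₀^{d-1} + d(d-1)·(C₁⁰)²·B₀^{d-2})`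
with `E₀(t) = e^{(τ/d) cos t}`. [cite: FitznerVanDerHofstad2016NoBLE, §5.1.1 (5.2)–(5.4)] -/
theorem integral_sum_cos_sq_mul_exp_P (hd : 2 ≤ d) (τ : ℝ) :
    ∫ k, (∑ j, Real.cos (k j)) ^ 2 * Real.exp (τ * Dhat d k) ∂P d
      = ((d : ℂ) * (∫ t, ((Real.cos t ^ 2 : ℝ) : ℂ) * Complex.exp (((τ / d * Real.cos t : ℝ) : ℂ)) ∂μI)
          * (∫ t, Complex.exp (((τ / d * Real.cos t : ℝ) : ℂ)) ∂μI) ^ (d - 1)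
        + (d : ℂ) * ((d : ℂ) - 1)
          * (∫ t, ((Real.cos t : ℝ) : ℂ) * Complex.exp (((τ / d * Real.cos t : ℝ) : ℂ)) ∂μI) ^ 2
          * (∫ t, Complex.exp (((τ / d * Real.cos t : ℝ) : ℂ)) ∂μI) ^ (d - 2)).re := by
  have h := integral_sum_cos_sq_mul_exp_mul_cos_P hd τ 0 0
  simp only [zero_mul, Complex.ofReal_zero, add_zero, Real.cos_zero, mul_one] at h
  exact h

section AxisAtomTwo

open Literature.Barriers.CriticalPhenomena.Slade2006Prop53 (μI P)

/-- **The cosine-defect / Schwinger inner integral with weight `D̂²`** factorises over coordinates: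
`∫ D̂(k)² (1 - cos(β d D̂^{(m e_i)}(k))) e^{-(1-D̂(k))τ} dk = e^{-τ} d^{-2} Re (F(τ,0) - F(τ,β))`,
`F(τ,β) = d·C₂·B^{d-1} + d(d-1)·C₁²·B^{d-2}`. [cite: FitznerVanDerHofstad2016NoBLE, §5.1.1 (5.2)–(5.4)] -/
theorem integral_Dhat_sq_mul_one_sub_cos_mul_exp_schwinger_single (hd : 2 ≤ d) (τ β : ℝ) (i : Fin d) (m : ℤ) :
    ∫ k, (|Dhat d k| ^ 2 * (1 - Real.cos (β * d * DhatSym d (Pi.single i m) k)))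
        * Real.exp (-((1 - Dhat d k) * τ)) ∂P d
      = Real.exp (-τ) / (d : ℝ) ^ 2 * (
        ((d : ℂ) * (∫ t, ((Real.cos t ^ 2 : ℝ) : ℂ) * Complex.exp (((τ / d * Real.cos t : ℝ) : ℂ)) ∂μI)
          * (∫ t, Complex.exp (((τ / d * Real.cos t : ℝ) : ℂ)) ∂μI) ^ (d - 1)
        + (d : ℂ) * ((d : ℂ) - 1)
          * (∫ t, ((Real.cos t : ℝ) : ℂ) * Complex.exp (((τ / d * Real.cos t : ℝ) : ℂ)) ∂μI) ^ 2
          * (∫ t, Complex.exp (((τ / d * Real.cos t : ℝ) : ℂ)) ∂μI) ^ (d - 2)).re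
        - ((d : ℂ) * (∫ t, ((Real.cos t ^ 2 : ℝ) : ℂ)
              * Complex.exp (((τ / d * Real.cos t : ℝ) : ℂ) + ((β * Real.cos (m * t) : ℝ) : ℂ) * Complex.I) ∂μI)
          * (∫ t, Complex.exp (((τ / d * Real.cos t : ℝ) : ℂ) + ((β * Real.cos (m * t) : ℝ) : ℂ) * Complex.I) ∂μI) ^ (d - 1)
        + (d : ℂ) * ((d : ℂ) - 1)
          * (∫ t, ((Real.cos t : ℝ) : ℂ)
              * Complex.exp (((τ / d * Real.cos t : ℝ) : ℂ) + ((β * Real.cos (m * t) : ℝ) : ℂ) * Complex.I) ∂μI) ^ 2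
          * (∫ t, Complex.exp (((τ / d * Real.cos t : ℝ) : ℂ) + ((β * Real.cos (m * t) : ℝ) : ℂ) * Complex.I) ∂μI) ^ (d - 2)).re) := by
  have hd0 : (d : ℝ) ≠ 0 := by exact_mod_cast (show d ≠ 0 by omega)
  have hph : ∀ k : Fin d → ℝ, β * d * DhatSym d (Pi.single i m) k = β * ∑ j, Real.cos (m * k j) := by
    intro k; rw [mul_assoc, natCast_mul_DhatSym_single_intCast]
  have hsq : ∀ k : Fin d → ℝ, |Dhat d k| ^ 2 = (∑ j, Real.cos (k j)) ^ 2 / (d : ℝ) ^ 2 := by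
    intro k; rw [sq_abs, Dhat, div_pow]
  have hexp : ∀ k : Fin d → ℝ, Real.exp (-((1 - Dhat d k) * τ)) = Real.exp (-τ) * Real.exp (τ * Dhat d k) := by
    intro k; rw [← Real.exp_add]; congr 1; ring
  have e : ∀ k : Fin d → ℝ, (|Dhat d k| ^ 2 * (1 - Real.cos (β * d * DhatSym d (Pi.single i m) k)))
        * Real.exp (-((1 - Dhat d k) * τ))
      = Real.exp (-τ) / (d : ℝ) ^ 2 * ((∑ j, Real.cos (k j)) ^ 2 * Real.exp (τ * Dhat d k)
          - (∑ j, Real.cos (k j)) ^ 2 * (Real.exp (τ * Dhat d k) * Real.cos (β * ∑ j, Real.cos (m * k j)))) := by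
    intro k; rw [hsq, hph, hexp]; field_simp
  simp_rw [e]
  have hD := continuous_Dhat d
  have i0 : Integrable (fun k : Fin d → ℝ => (∑ j, Real.cos (k j)) ^ 2 * Real.exp (τ * Dhat d k)) (P d) := by
    have h := (integrable_sum_cos_sq_mul_cexp (d := d) τ 0 m).re
    refine h.congr (ae_of_all _ fun k => ?_)
    simp only [zero_mul, Complex.ofReal_zero, add_zero]
    rw [RCLike.re_to_complex, Complex.re_ofReal_mul, Complex.exp_ofReal_re]
  have i1 : Integrable (fun k : Fin d → ℝ => (∑ j, Real.cos (k j)) ^ 2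
      * (Real.exp (τ * Dhat d k) * Real.cos (β * ∑ j, Real.cos (m * k j)))) (P d) := by
    have h := (integrable_sum_cos_sq_mul_cexp (d := d) τ β m).re
    refine h.congr (ae_of_all _ fun k => ?_)
    simp only
    rw [RCLike.re_to_complex, Complex.re_ofReal_mul, Complex.exp_re, Complex.add_re, Complex.ofReal_re,
      Complex.re_ofReal_mul, Complex.I_re, mul_zero, add_zero, Complex.add_im, Complex.ofReal_im,
      Complex.im_ofReal_mul, Complex.I_im, mul_one, zero_add]
  rw [integral_const_mul, integral_sub i0 i1, integral_sum_cos_sq_mul_exp_P hd,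
    integral_sum_cos_sq_mul_exp_mul_cos_P hd]

/-- **The `l = 2` axis atoms as one explicit double integral**: for `d ≥ 2n + 3`, every axis `i`, every `m : ℤ`,
`K_{n+1,2}(m e_i) = (2/(πd)) ∫₀^∞ β^{-2} [(n!)^{-1} ∫₀^∞ τⁿ e^{-τ} d^{-2} Re (F(τ,0) - F(τ,β)) dτ] /(2π)^d dβ`
(`l = 2` twin of `srwK_succ_zero_single_eq_integral_axisTransform`).
[cite: FitznerVanDerHofstad2016NoBLE, (3.34)–(3.36) p. 1071] -/
theorem srwK_succ_two_single_eq_integral_axisTransform (n : ℕ) (hd : 2 * (n + 1) + 1 ≤ d)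
    (i : Fin d) (m : ℤ) :
    srwK d (n + 1) 2 (Pi.single i m) = 2 / (π * d) * ∫ β in Ioi (0:ℝ),
      ((n ! : ℝ)⁻¹ * (∫ τ in Ioi (0:ℝ), τ ^ n * (Real.exp (-τ) / (d : ℝ) ^ 2 * (
        ((d : ℂ) * (∫ t, ((Real.cos t ^ 2 : ℝ) : ℂ) * Complex.exp (((τ / d * Real.cos t : ℝ) : ℂ)) ∂μI)
          * (∫ t, Complex.exp (((τ / d * Real.cos t : ℝ) : ℂ)) ∂μI) ^ (d - 1)
        + (d : ℂ) * ((d : ℂ) - 1)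
          * (∫ t, ((Real.cos t : ℝ) : ℂ) * Complex.exp (((τ / d * Real.cos t : ℝ) : ℂ)) ∂μI) ^ 2
          * (∫ t, Complex.exp (((τ / d * Real.cos t : ℝ) : ℂ)) ∂μI) ^ (d - 2)).re
        - ((d : ℂ) * (∫ t, ((Real.cos t ^ 2 : ℝ) : ℂ)
              * Complex.exp (((τ / d * Real.cos t : ℝ) : ℂ) + ((β * Real.cos (m * t) : ℝ) : ℂ) * Complex.I) ∂μI)
          * (∫ t, Complex.exp (((τ / d * Real.cos t : ℝ) : ℂ) + ((β * Real.cos (m * t) : ℝ) : ℂ) * Complex.I) ∂μI) ^ (d - 1)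
        + (d : ℂ) * ((d : ℂ) - 1)
          * (∫ t, ((Real.cos t : ℝ) : ℂ)
              * Complex.exp (((τ / d * Real.cos t : ℝ) : ℂ) + ((β * Real.cos (m * t) : ℝ) : ℂ) * Complex.I) ∂μI) ^ 2
          * (∫ t, Complex.exp (((τ / d * Real.cos t : ℝ) : ℂ) + ((β * Real.cos (m * t) : ℝ) : ℂ) * Complex.I) ∂μI) ^ (d - 2)).re)))
        / (2 * π) ^ d) / β ^ 2 := by
  have hd2 : 2 ≤ d := by omega
  rw [srwK_eq_integral_cosDefect_scaled hd 2 (Pi.single i m)]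
  congr 1
  refine setIntegral_congr_fun measurableSet_Ioi fun β _ => ?_
  have hWm : AEStronglyMeasurable
      (fun k : Fin d → ℝ => |Dhat d k| ^ 2 * (1 - Real.cos (β * d * DhatSym d (Pi.single i m) k))) (P d) :=
    Continuous.aestronglyMeasurable (by
      have := continuous_DhatSym d (Pi.single i m); have := continuous_Dhat d; fun_prop)
  have hW : Integrable
      (fun k : Fin d → ℝ => (|Dhat d k| ^ 2 * (1 - Real.cos (β * d * DhatSym d (Pi.single i m) k)))
        * Chat d 1 k ^ (n + 1)) (P d) :=
    (integrable_Chat_pow (n + 1) hd zero_le_one le_rfl).bdd_mul hWm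
      (ae_of_all _ fun k => by
        rw [Real.norm_eq_abs, abs_mul]
        have h1 := Real.abs_cos_le_one (β * d * DhatSym d (Pi.single i m) k)
        have h2 : |1 - Real.cos (β * d * DhatSym d (Pi.single i m) k)| ≤ 2 := by
          rw [abs_le] at h1 ⊢; constructor <;> linarith [h1.1, h1.2]
        have h3 : |(|Dhat d k| ^ 2)| ≤ 1 := by
          rw [abs_of_nonneg (sq_nonneg _)]; exact abs_Dhat_pow_le_one 2 k
        calc _ ≤ 1 * 2 := mul_le_mul h3 h2 (abs_nonneg _) zero_le_one
          _ = (1 : ℝ) * 2 := rfl)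
  have key : ∫ τ in Ioi (0:ℝ), τ ^ n * ∫ k, (|Dhat d k| ^ 2 * (1 - Real.cos (β * d * DhatSym d (Pi.single i m) k)))
        * Real.exp (-((1 - Dhat d k) * τ)) ∂P d
      = ∫ τ in Ioi (0:ℝ), τ ^ n * (Real.exp (-τ) / (d : ℝ) ^ 2 * (
        ((d : ℂ) * (∫ t, ((Real.cos t ^ 2 : ℝ) : ℂ) * Complex.exp (((τ / d * Real.cos t : ℝ) : ℂ)) ∂μI)
          * (∫ t, Complex.exp (((τ / d * Real.cos t : ℝ) : ℂ)) ∂μI) ^ (d - 1)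
        + (d : ℂ) * ((d : ℂ) - 1)
          * (∫ t, ((Real.cos t : ℝ) : ℂ) * Complex.exp (((τ / d * Real.cos t : ℝ) : ℂ)) ∂μI) ^ 2
          * (∫ t, Complex.exp (((τ / d * Real.cos t : ℝ) : ℂ)) ∂μI) ^ (d - 2)).re
        - ((d : ℂ) * (∫ t, ((Real.cos t ^ 2 : ℝ) : ℂ)
              * Complex.exp (((τ / d * Real.cos t : ℝ) : ℂ) + ((β * Real.cos (m * t) : ℝ) : ℂ) * Complex.I) ∂μI)
          * (∫ t, Complex.exp (((τ / d * Real.cos t : ℝ) : ℂ) + ((β * Real.cos (m * t) : ℝ) : ℂ) * Complex.I) ∂μI) ^ (d - 1)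
        + (d : ℂ) * ((d : ℂ) - 1)
          * (∫ t, ((Real.cos t : ℝ) : ℂ)
              * Complex.exp (((τ / d * Real.cos t : ℝ) : ℂ) + ((β * Real.cos (m * t) : ℝ) : ℂ) * Complex.I) ∂μI) ^ 2
          * (∫ t, Complex.exp (((τ / d * Real.cos t : ℝ) : ℂ) + ((β * Real.cos (m * t) : ℝ) : ℂ) * Complex.I) ∂μI) ^ (d - 2)).re)) :=
    setIntegral_congr_fun measurableSet_Ioi fun τ _ => by
      rw [integral_Dhat_sq_mul_one_sub_cos_mul_exp_schwinger_single hd2]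
  rw [integral_mul_Chat_pow_succ_eq_integral_Ioi n hWm hW, key]

end AxisAtomTwo

/-! ### The `τ = 0` slice and `K_{0,2}(m e_i)` -/
section TauZero

/-- **`τ = 0` slice** of `integral_Dhat_sq_mul_one_sub_cos_mul_exp_schwinger_single`: the plain
two-cosine-defect integral `∫ D̂² (1 - cos(β d D̂^{(m e_i)})) dP` (no Schwinger weight), i.e. the
inner integral of `K_{0,2}(m e_i)`; the untwisted factors are the elementary `∫ 1 = 2π`,
`∫ cos = 0`, `∫ cos² = π` and the twisted ones are Bessel-`J`-type (`∫ e^{iβ cos(mt)} dμI = 2π J₀(β)`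
for `m ≠ 0`). [cite: FitznerVanDerHofstad2016NoBLE, §5.1.1 (5.2)–(5.4); (3.36) p. 1071] -/
theorem integral_Dhat_sq_mul_one_sub_cos_single (hd : 2 ≤ d) (β : ℝ) (i : Fin d) (m : ℤ) :
    ∫ k, |Dhat d k| ^ 2 * (1 - Real.cos (β * d * DhatSym d (Pi.single i m) k)) ∂P d
      = 1 / (d : ℝ) ^ 2 * (((d : ℂ) * (∫ t, ((Real.cos t ^ 2 : ℝ) : ℂ) ∂μI) * (∫ _t, (1 : ℂ) ∂μI) ^ (d - 1)
            + (d : ℂ) * ((d : ℂ) - 1) * (∫ t, ((Real.cos t : ℝ) : ℂ) ∂μI) ^ 2 * (∫ _t, (1 : ℂ) ∂μI) ^ (d - 2)).re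
          - ((d : ℂ) * (∫ t, ((Real.cos t ^ 2 : ℝ) : ℂ) * Complex.exp (((β * Real.cos (m * t) : ℝ) : ℂ) * Complex.I) ∂μI)
              * (∫ t, Complex.exp (((β * Real.cos (m * t) : ℝ) : ℂ) * Complex.I) ∂μI) ^ (d - 1)
            + (d : ℂ) * ((d : ℂ) - 1)
              * (∫ t, ((Real.cos t : ℝ) : ℂ) * Complex.exp (((β * Real.cos (m * t) : ℝ) : ℂ) * Complex.I) ∂μI) ^ 2
              * (∫ t, Complex.exp (((β * Real.cos (m * t) : ℝ) : ℂ) * Complex.I) ∂μI) ^ (d - 2)).re) := by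
  have h := integral_Dhat_sq_mul_one_sub_cos_mul_exp_schwinger_single hd 0 β i m
  simp only [mul_zero, neg_zero, Real.exp_zero, mul_one, zero_div, zero_mul, Complex.ofReal_zero,
    zero_add, Complex.exp_zero] at h
  simpa only [mul_one] using h

/-- **`K_{0,2}(m e_i)` as a single `β`-integral** ((3.36) with `n = 0`, `l = 2`): the cosine-defect
formula `srwK_eq_integral_cosDefect_scaled` at `n = 0` combined with the `τ = 0` slice above.
[cite: FitznerVanDerHofstad2016NoBLE, (3.36) p. 1071; §5.1.1 (5.2)–(5.4)] -/
theorem srwK_zero_two_single_eq_integral (hd : 2 ≤ d) (i : Fin d) (m : ℤ) :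
    srwK d 0 2 (Pi.single i m) = 2 / (π * d) * ∫ β in Ioi (0:ℝ),
      ((1 / (d : ℝ) ^ 2 * (((d : ℂ) * (∫ t, ((Real.cos t ^ 2 : ℝ) : ℂ) ∂μI) * (∫ _t, (1 : ℂ) ∂μI) ^ (d - 1)
            + (d : ℂ) * ((d : ℂ) - 1) * (∫ t, ((Real.cos t : ℝ) : ℂ) ∂μI) ^ 2 * (∫ _t, (1 : ℂ) ∂μI) ^ (d - 2)).re
          - ((d : ℂ) * (∫ t, ((Real.cos t ^ 2 : ℝ) : ℂ) * Complex.exp (((β * Real.cos (m * t) : ℝ) : ℂ) * Complex.I) ∂μI)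
              * (∫ t, Complex.exp (((β * Real.cos (m * t) : ℝ) : ℂ) * Complex.I) ∂μI) ^ (d - 1)
            + (d : ℂ) * ((d : ℂ) - 1)
              * (∫ t, ((Real.cos t : ℝ) : ℂ) * Complex.exp (((β * Real.cos (m * t) : ℝ) : ℂ) * Complex.I) ∂μI) ^ 2
              * (∫ t, Complex.exp (((β * Real.cos (m * t) : ℝ) : ℂ) * Complex.I) ∂μI) ^ (d - 2)).re)) / (2 * π) ^ d) / β ^ 2 := by
  rw [srwK_eq_integral_cosDefect_scaled (n := 0) (by omega) 2 (Pi.single i m)]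
  congr 1
  refine setIntegral_congr_fun measurableSet_Ioi (fun β _ => ?_)
  rw [← integral_Dhat_sq_mul_one_sub_cos_single hd β i m]
  congr 2
  refine integral_congr_ae (ae_of_all _ fun k => ?_)
  simp only [pow_zero, mul_one]

end TauZero

/-! ### The `τ = 0` twisted zeroth factor is `2π J₀(β)` for every `m ≠ 0` -/
section BesselJ

open Literature.Analysis.FunctionSpaces (besselJ)

/-- Full-period dilation by a positive natural number: `∫_{-π}^{π} g(n t) dt = ∫_{-π}^{π} g(t) dt`
for continuous `2π`-periodic `g`. [folklore] -/
private theorem intervalIntegral_comp_natCast_mul_period {g : ℝ → ℂ} (hg : Continuous g)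
    (hper : Function.Periodic g (2 * π)) {n : ℕ} (hn : 0 < n) :
    ∫ t in (-π)..π, g (n * t) = ∫ t in (-π)..π, g t := by
  have hn' : (n : ℝ) ≠ 0 := by exact_mod_cast hn.ne'
  rw [intervalIntegral.integral_comp_mul_left g hn']
  have h := hper.intervalIntegral_add_zsmul_eq (n : ℤ) (n * -π) (fun t₁ t₂ => hg.intervalIntegrable t₁ t₂)
  have hend : (n : ℝ) * -π + (n : ℤ) • (2 * π) = n * π := by
    rw [zsmul_eq_mul, Int.cast_natCast]; ring
  rw [hend] at h
  rw [h, hper.intervalIntegral_add_eq (n * -π) (-π), show -π + 2 * π = π by ring]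
  rw [← Int.cast_smul_eq_zsmul ℝ, Int.cast_natCast, smul_smul, inv_mul_cancel₀ hn', one_smul]

/-- **`τ = 0` twisted factor**: `∫ e^{iβ cos(m t)} dμI = 2π J₀(β)` for every integer `m ≠ 0`
(full-period dilation + `integral_cexp_mul_cos_μI`). [cite: DLMF, 10.9.2] -/
theorem integral_cexp_mul_cos_int_mul_μI (β : ℝ) {m : ℤ} (hm : m ≠ 0) :
    ∫ t, Complex.exp (((β * Real.cos (m * t) : ℝ) : ℂ) * Complex.I) ∂μI
      = ((2 * π * besselJ 0 β : ℝ) : ℂ) := by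
  rw [← integral_cexp_mul_cos_μI β]
  have hg : Continuous fun t : ℝ => Complex.exp (((β * Real.cos t : ℝ) : ℂ) * Complex.I) := by fun_prop
  have hper : Function.Periodic (fun t : ℝ => Complex.exp (((β * Real.cos t : ℝ) : ℂ) * Complex.I)) (2 * π) := by
    intro t; simp only [Real.cos_add_two_pi]
  -- reduce to `m.natAbs` by evenness of `cos`
  have hcos : ∀ t : ℝ, Real.cos (m * t) = Real.cos ((m.natAbs : ℕ) * t) := by
    intro t
    rcases Int.natAbs_eq m with h | h
    · conv_lhs => rw [h]
      simp
    · conv_lhs => rw [h]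
      simp [Real.cos_neg, neg_mul]
  simp_rw [hcos]
  have hn : 0 < m.natAbs := Int.natAbs_pos.2 hm
  rw [show μI = volume.restrict (Icc (-π) π) from rfl, integral_Icc_eq_integral_Ioc,
    ← intervalIntegral.integral_of_le (by linarith [Real.pi_pos]),
    integral_Icc_eq_integral_Ioc, ← intervalIntegral.integral_of_le (by linarith [Real.pi_pos])]
  exact intervalIntegral_comp_natCast_mul_period hg hper hn

end BesselJ

/-! ### Shift-averaging over roots of unity: the `τ = 0` twisted factors `C₁`, `C₂` -/
section ShiftAverage

open MeasureTheory Set Real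

/-- `Σ_{j<n} cos(k t + 2πkj/n) = 0` whenever `n ∤ k` (real part of `e^{ikt} Σ_j (ζ^k)^j` with
`ζ^k ≠ 1` an `n`-th root of unity). [folklore] -/
private theorem sum_cos_mul_add_eq_zero (t : ℝ) {n k : ℕ} (hn : 0 < n) (hk : ¬ n ∣ k) :
    ∑ j ∈ Finset.range n, Real.cos (k * t + 2 * π * k * j / n) = 0 := by
  have hζ := Complex.isPrimitiveRoot_exp n hn.ne'
  have hne : Complex.exp (2 * π * Complex.I / n) ^ k ≠ 1 := by
    rw [Ne, hζ.pow_eq_one_iff_dvd]; exact hk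
  have hpow : (Complex.exp (2 * π * Complex.I / n) ^ k) ^ n = 1 := by
    rw [← pow_mul, mul_comm k n, pow_mul, hζ.pow_eq_one, one_pow]
  have hs : ∑ j ∈ Finset.range n, (Complex.exp (2 * π * Complex.I / n) ^ k) ^ j = 0 := by
    have := geom_sum_mul (Complex.exp (2 * π * Complex.I / n) ^ k) n
    rw [hpow, sub_self] at this
    exact (mul_eq_zero.1 this).resolve_right (sub_ne_zero.2 hne)
  have h1 : ∀ j : ℕ, Real.cos (k * t + 2 * π * k * j / n)
      = (Complex.exp ((k * t : ℝ) * Complex.I) * ((Complex.exp (2 * π * Complex.I / n) ^ k) ^ j)).re := by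
    intro j
    rw [← pow_mul, ← Complex.exp_nat_mul, ← Complex.exp_add, ← Complex.exp_ofReal_mul_I_re]
    congr 2
    push_cast; ring
  simp_rw [h1, ← Complex.re_sum, ← Finset.mul_sum, hs, mul_zero, Complex.zero_re]

/-- Shift invariance of a full-period integral of a `2π`-periodic function:
`∫_{-π}^{π} h(t + c) dt = ∫_{-π}^{π} h(t) dt`. [folklore] -/
private theorem intervalIntegral_comp_add_period {h : ℝ → ℂ}
    (hper : Function.Periodic h (2 * π)) (c : ℝ) :
    ∫ t in (-π)..π, h (t + c) = ∫ t in (-π)..π, h t := by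
  rw [intervalIntegral.integral_comp_add_right h c]
  have := hper.intervalIntegral_add_eq (-π + c) (-π)
  rw [show -π + c + 2 * π = π + c by ring, show -π + 2 * π = π by ring] at this
  exact this

/-- **Shift-averaging, general frequency**: `∫_{-π}^{π} cos(k t) · g(n t) dt = 0` for continuous
`2π`-periodic `g : ℝ → ℂ` whenever `n ∤ k`. [cite: FitznerVanDerHofstad2016NoBLE, §5.1.1 (5.2)–(5.4)] -/
theorem intervalIntegral_cos_mul_mul_comp_natCast_mul_eq_zero {g : ℝ → ℂ} (hg : Continuous g)
    (hper : Function.Periodic g (2 * π)) {n k : ℕ} (hn : 0 < n) (hk : ¬ n ∣ k) :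
    ∫ t in (-π)..π, ((Real.cos (k * t) : ℝ) : ℂ) * g (n * t) = 0 := by
  set h : ℝ → ℂ := fun t => ((Real.cos (k * t) : ℝ) : ℂ) * g (n * t) with hdef
  have hhper : Function.Periodic h (2 * π) := by
    intro t
    simp only [hdef, mul_add]
    rw [show (k : ℝ) * (2 * π) = (k : ℕ) * (2 * π) by rfl, Real.cos_add_nat_mul_two_pi,
      show (n : ℝ) * (2 * π) = (n : ℕ) • (2 * π) by rw [nsmul_eq_mul], hper.nsmul n]
  have hshift : ∀ j : ℕ, ∫ t in (-π)..π, h t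
      = ∫ t in (-π)..π, ((Real.cos (k * t + 2 * π * k * j / n) : ℝ) : ℂ) * g (n * t) := by
    intro j
    rw [← intervalIntegral_comp_add_period hhper (2 * π * j / n)]
    refine intervalIntegral.integral_congr (fun t _ => ?_)
    simp only [hdef]
    have hn0 : (n : ℝ) ≠ 0 := by exact_mod_cast hn.ne'
    have harg : (n : ℝ) * (t + 2 * π * j / n) = n * t + (j : ℕ) • (2 * π) := by
      rw [nsmul_eq_mul]; field_simp
    rw [harg, hper.nsmul j]
    congr 3
    ring
  have hint : ∀ j : ℕ, IntervalIntegrable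
      (fun t => ((Real.cos (k * t + 2 * π * k * j / n) : ℝ) : ℂ) * g (n * t)) volume (-π) π := by
    intro j
    exact (Continuous.intervalIntegrable (by fun_prop) _ _)
  have hsum : (n : ℂ) * ∫ t in (-π)..π, h t
      = ∫ t in (-π)..π, (∑ j ∈ Finset.range n, ((Real.cos (k * t + 2 * π * k * j / n) : ℝ) : ℂ)) * g (n * t) := by
    rw [show (n : ℂ) * ∫ t in (-π)..π, h t = ∑ j ∈ Finset.range n, ∫ t in (-π)..π, h t by
      rw [Finset.sum_const, Finset.card_range, nsmul_eq_mul]]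
    rw [Finset.sum_congr rfl fun j _ => hshift j, ← intervalIntegral.integral_finsetSum fun j _ => hint j]
    refine intervalIntegral.integral_congr (fun t _ => ?_)
    simp only [Finset.sum_mul]
  have hzero : ∀ t : ℝ, (∑ j ∈ Finset.range n, ((Real.cos (k * t + 2 * π * k * j / n) : ℝ) : ℂ)) = 0 := by
    intro t; rw [← Complex.ofReal_sum, sum_cos_mul_add_eq_zero t hn hk, Complex.ofReal_zero]
  simp_rw [hzero, zero_mul, intervalIntegral.integral_zero] at hsum
  have hnC : (n : ℂ) ≠ 0 := by exact_mod_cast hn.ne'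
  simpa [hdef] using (mul_eq_zero.1 hsum).resolve_left hnC

/-- **Shift-averaging**: `∫_{-π}^{π} cos t · g(n t) dt = 0` for continuous `2π`-periodic `g : ℝ → ℂ`
and `n ≥ 2` (average over the shifts `t ↦ t + 2πj/n`, `j < n`, under which `g(n·)` is invariant, and
`Σ_j cos(t + 2πj/n) = 0`). [cite: FitznerVanDerHofstad2016NoBLE, §5.1.1 (5.2)–(5.4)] -/
theorem intervalIntegral_cos_mul_comp_natCast_mul_eq_zero {g : ℝ → ℂ} (hg : Continuous g)
    (hper : Function.Periodic g (2 * π)) {n : ℕ} (hn : 2 ≤ n) :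
    ∫ t in (-π)..π, ((Real.cos t : ℝ) : ℂ) * g (n * t) = 0 := by
  have h := intervalIntegral_cos_mul_mul_comp_natCast_mul_eq_zero hg hper (n := n) (k := 1) (by omega)
    (by rw [Nat.dvd_one]; omega)
  simpa only [Nat.cast_one, one_mul] using h


open Literature.Barriers.CriticalPhenomena
open Literature.Barriers.CriticalPhenomena.Slade2006Prop53 (μI P)

/-- **`C₁(0,β) = 0` for `|m| ≥ 2`**: the `τ = 0` twisted first factor
`∫ cos t · e^{iβ cos(m t)} dμI` vanishes when `|m| ≥ 2` (shift-averaging over the `|m|`-th roots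
of unity). [cite: FitznerVanDerHofstad2016NoBLE, §5.1.1 (5.2)–(5.4)] -/
theorem integral_cos_mul_cexp_mul_cos_int_mul_μI_eq_zero (β : ℝ) {m : ℤ} (hm : 2 ≤ |m|) :
    ∫ t, ((Real.cos t : ℝ) : ℂ) * Complex.exp (((β * Real.cos (m * t) : ℝ) : ℂ) * Complex.I) ∂μI = 0 := by
  have hg : Continuous fun s : ℝ => Complex.exp (((β * Real.cos s : ℝ) : ℂ) * Complex.I) := by fun_prop
  have hper : Function.Periodic (fun s : ℝ => Complex.exp (((β * Real.cos s : ℝ) : ℂ) * Complex.I)) (2 * π) := by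
    intro s; simp only [Real.cos_add_two_pi]
  have hcos : ∀ t : ℝ, Real.cos (m * t) = Real.cos ((m.natAbs : ℕ) * t) := by
    intro t
    rcases Int.natAbs_eq m with h | h
    · conv_lhs => rw [h]
      simp
    · conv_lhs => rw [h]
      simp [Real.cos_neg, neg_mul]
  simp_rw [hcos]
  have hn : 2 ≤ m.natAbs := by
    zify; exact hm
  rw [show μI = volume.restrict (Icc (-π) π) from rfl, integral_Icc_eq_integral_Ioc,
    ← intervalIntegral.integral_of_le (by linarith [Real.pi_pos])]
  exact intervalIntegral_cos_mul_comp_natCast_mul_eq_zero hg hper hn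

/-- **`C₂(0,β) = ½·B(0,β)` for `|m| ≥ 3`**: with `cos² t = ½ + ½ cos 2t` the `cos 2t` part of the
second twisted factor dies by shift-averaging (`|m| ∤ 2`), so
`∫ cos² t · e^{iβ cos(m t)} dμI = ½ ∫ e^{iβ cos(m t)} dμI` (`= π J₀(β)`).
[cite: FitznerVanDerHofstad2016NoBLE, §5.1.1 (5.2)–(5.4)] -/
theorem integral_cos_sq_mul_cexp_mul_cos_int_mul_μI (β : ℝ) {m : ℤ} (hm : 3 ≤ |m|) :
    ∫ t, ((Real.cos t ^ 2 : ℝ) : ℂ) * Complex.exp (((β * Real.cos (m * t) : ℝ) : ℂ) * Complex.I) ∂μI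
      = (1 / 2 : ℂ) * ∫ t, Complex.exp (((β * Real.cos (m * t) : ℝ) : ℂ) * Complex.I) ∂μI := by
  have hg : Continuous fun s : ℝ => Complex.exp (((β * Real.cos s : ℝ) : ℂ) * Complex.I) := by fun_prop
  have hper : Function.Periodic (fun s : ℝ => Complex.exp (((β * Real.cos s : ℝ) : ℂ) * Complex.I)) (2 * π) := by
    intro s; simp only [Real.cos_add_two_pi]
  have hcos : ∀ t : ℝ, Real.cos (m * t) = Real.cos ((m.natAbs : ℕ) * t) := by
    intro t
    rcases Int.natAbs_eq m with h | h
    · conv_lhs => rw [h]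
      simp
    · conv_lhs => rw [h]
      simp [Real.cos_neg, neg_mul]
  simp_rw [hcos]
  have hn3 : 3 ≤ m.natAbs := by zify; exact hm
  have hfin : IsFiniteMeasure μI := by
    rw [show μI = volume.restrict (Icc (-π) π) from rfl]; infer_instance
  have hE : Integrable (fun t : ℝ => Complex.exp (((β * Real.cos ((m.natAbs : ℕ) * t) : ℝ) : ℂ) * Complex.I)) μI :=
    (integrable_const (1:ℝ)).mono' (Continuous.aestronglyMeasurable (by fun_prop))
      (ae_of_all _ fun t => by rw [Complex.norm_exp_ofReal_mul_I])
  have hC : Integrable (fun t : ℝ => ((Real.cos (2 * t) : ℝ) : ℂ)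
      * Complex.exp (((β * Real.cos ((m.natAbs : ℕ) * t) : ℝ) : ℂ) * Complex.I)) μI :=
    (integrable_const (1:ℝ)).mono' (Continuous.aestronglyMeasurable (by fun_prop))
      (ae_of_all _ fun t => by
        rw [norm_mul, Complex.norm_real, Complex.norm_exp_ofReal_mul_I, mul_one, Real.norm_eq_abs]
        exact Real.abs_cos_le_one _)
  have hsplit : ∀ t : ℝ, ((Real.cos t ^ 2 : ℝ) : ℂ)
      * Complex.exp (((β * Real.cos ((m.natAbs : ℕ) * t) : ℝ) : ℂ) * Complex.I)
      = (1 / 2 : ℂ) * Complex.exp (((β * Real.cos ((m.natAbs : ℕ) * t) : ℝ) : ℂ) * Complex.I)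
        + (1 / 2 : ℂ) * (((Real.cos (2 * t) : ℝ) : ℂ)
          * Complex.exp (((β * Real.cos ((m.natAbs : ℕ) * t) : ℝ) : ℂ) * Complex.I)) := by
    intro t; rw [Real.cos_sq]; push_cast; ring
  simp_rw [hsplit]
  rw [integral_add (hE.const_mul _) (hC.const_mul _), integral_const_mul, integral_const_mul]
  have hzero : ∫ t, ((Real.cos (2 * t) : ℝ) : ℂ)
      * Complex.exp (((β * Real.cos ((m.natAbs : ℕ) * t) : ℝ) : ℂ) * Complex.I) ∂μI = 0 := by
    rw [show μI = volume.restrict (Icc (-π) π) from rfl, integral_Icc_eq_integral_Ioc,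
      ← intervalIntegral.integral_of_le (by linarith [Real.pi_pos])]
    have h := intervalIntegral_cos_mul_mul_comp_natCast_mul_eq_zero hg hper (k := 2) (n := m.natAbs)
      (by omega) (fun hd => by have := Nat.le_of_dvd (by norm_num) hd; omega)
    simpa only [Nat.cast_ofNat] using h
  rw [hzero, mul_zero, add_zero]

end ShiftAverage

section JOne
open Literature.Analysis.FunctionSpaces (besselJ hasDerivAt_besselJ_zero_holds)

/-- Dominated differentiation under the integral sign of the `J₀` characteristic function:
`β ↦ ∫ e^{iβ cos t} dμI` has derivative `∫ e^{iβ cos t}·(i cos t) dμI` (the integrand's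
`β`-derivative has norm `≤ 1`, integrable on the finite measure `μI`).
[cite: DLMF, 10.9.2] -/
theorem hasDerivAt_integral_cexp_mul_cos_μI (β : ℝ) :
    HasDerivAt (fun b : ℝ => ∫ t, Complex.exp (((b * Real.cos t : ℝ) : ℂ) * Complex.I) ∂μI)
      (∫ t, Complex.exp (((β * Real.cos t : ℝ) : ℂ) * Complex.I)
        * (((Real.cos t : ℝ) : ℂ) * Complex.I) ∂μI) β := by
  have h := hasDerivAt_integral_of_dominated_loc_of_deriv_le (μ := μI) (x₀ := β) (s := univ)
    (F := fun (b : ℝ) (t : ℝ) => Complex.exp (((b * Real.cos t : ℝ) : ℂ) * Complex.I))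
    (F' := fun (b : ℝ) (t : ℝ) => Complex.exp (((b * Real.cos t : ℝ) : ℂ) * Complex.I)
      * (((Real.cos t : ℝ) : ℂ) * Complex.I))
    (bound := fun _ => 1) Filter.univ_mem ?_ ?_ ?_ ?_ ?_ ?_
  · exact h.2
  · exact Filter.Eventually.of_forall fun b =>
      (by fun_prop : Continuous fun t : ℝ =>
        Complex.exp (((b * Real.cos t : ℝ) : ℂ) * Complex.I)).aestronglyMeasurable
  · exact (integrable_const (1 : ℝ)).mono'
      (by fun_prop : Continuous fun t : ℝ =>
        Complex.exp (((β * Real.cos t : ℝ) : ℂ) * Complex.I)).aestronglyMeasurable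
      (ae_of_all _ fun t => by rw [Complex.norm_exp_ofReal_mul_I])
  · exact (by fun_prop : Continuous fun t : ℝ => Complex.exp (((β * Real.cos t : ℝ) : ℂ) * Complex.I)
      * (((Real.cos t : ℝ) : ℂ) * Complex.I)).aestronglyMeasurable
  · refine ae_of_all _ fun t b _ => ?_
    rw [norm_mul, Complex.norm_exp_ofReal_mul_I, one_mul, norm_mul, Complex.norm_I, mul_one,
      Complex.norm_real, Real.norm_eq_abs]
    exact Real.abs_cos_le_one t
  · exact integrable_const 1
  · refine ae_of_all _ fun t b _ => ?_
    have h1 : HasDerivAt (fun b : ℝ => ((b * Real.cos t : ℝ) : ℂ) * Complex.I)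
        (((Real.cos t : ℝ) : ℂ) * Complex.I) b := by
      have h0 : HasDerivAt (fun b : ℝ => b * Real.cos t) (Real.cos t) b := by
        simpa using (hasDerivAt_id b).mul_const (Real.cos t)
      exact h0.ofReal_comp.mul_const Complex.I
    exact h1.cexp

/-- **The twisted first factor at `|m| = 1`**: `∫ cos t · e^{iβ cos t} dμI = 2πi·J₁(β)` — the
derivative of Bessel's integral `2πJ₀(β)` is `-2πJ₁(β)` (`J₀' = -J₁`), and it is also
`i ∫ cos t · e^{iβ cos t} dμI` by differentiation under the integral sign.
[cite: DLMF, 10.9.2 and 10.6.3] -/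
theorem integral_cos_mul_cexp_mul_cos_μI (β : ℝ) :
    ∫ t, ((Real.cos t : ℝ) : ℂ) * Complex.exp (((β * Real.cos t : ℝ) : ℂ) * Complex.I) ∂μI
      = ((2 * π * besselJ 1 β : ℝ) : ℂ) * Complex.I := by
  have hD := hasDerivAt_integral_cexp_mul_cos_μI β
  have hfun : (fun b : ℝ => ∫ t, Complex.exp (((b * Real.cos t : ℝ) : ℂ) * Complex.I) ∂μI)
      = fun b => ((2 * π * besselJ 0 b : ℝ) : ℂ) := funext fun b => integral_cexp_mul_cos_μI b
  rw [hfun] at hD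
  have hJ : HasDerivAt (fun b : ℝ => ((2 * π * besselJ 0 b : ℝ) : ℂ))
      (((2 * π * (-besselJ 1 β) : ℝ) : ℂ)) β :=
    ((hasDerivAt_besselJ_zero_holds β).const_mul (2 * π)).ofReal_comp
  have heq := hD.unique hJ
  have hre : (fun t : ℝ => Complex.exp (((β * Real.cos t : ℝ) : ℂ) * Complex.I)
        * (((Real.cos t : ℝ) : ℂ) * Complex.I))
      = fun t => Complex.I * (((Real.cos t : ℝ) : ℂ)
        * Complex.exp (((β * Real.cos t : ℝ) : ℂ) * Complex.I)) := by
    funext t; ring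
  rw [hre, integral_const_mul] at heq
  set X := ∫ t, ((Real.cos t : ℝ) : ℂ) * Complex.exp (((β * Real.cos t : ℝ) : ℂ) * Complex.I) ∂μI
  have hX : X = -Complex.I * (Complex.I * X) := by
    rw [← mul_assoc, neg_mul, Complex.I_mul_I, neg_neg, one_mul]
  rw [hX, heq]
  push_cast
  ring

/-- Full-period dilation by a positive natural number: `∫_{-π}^{π} g(n t) dt = ∫_{-π}^{π} g(t) dt`
for continuous `2π`-periodic `g`. [folklore] -/
private theorem intervalIntegral_comp_natCast_mul_period' {g : ℝ → ℂ} (hg : Continuous g)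
    (hper : Function.Periodic g (2 * π)) {n : ℕ} (hn : 0 < n) :
    ∫ t in (-π)..π, g (n * t) = ∫ t in (-π)..π, g t := by
  have hn' : (n : ℝ) ≠ 0 := by exact_mod_cast hn.ne'
  rw [intervalIntegral.integral_comp_mul_left g hn']
  have h := hper.intervalIntegral_add_zsmul_eq (n : ℤ) (n * -π) (fun t₁ t₂ => hg.intervalIntegrable t₁ t₂)
  have hend : (n : ℝ) * -π + (n : ℤ) • (2 * π) = n * π := by
    rw [zsmul_eq_mul, Int.cast_natCast]; ring
  rw [hend] at h
  rw [h, hper.intervalIntegral_add_eq (n * -π) (-π), show -π + 2 * π = π by ring]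
  rw [← Int.cast_smul_eq_zsmul ℝ, Int.cast_natCast, smul_smul, inv_mul_cancel₀ hn', one_smul]

/-- `μI`-integrals of a dilated continuous `2π`-periodic function: `∫ g(2t) dμI = ∫ g(t) dμI`.
[folklore] -/
private theorem integral_comp_two_mul_μI {g : ℝ → ℂ} (hg : Continuous g)
    (hper : Function.Periodic g (2 * π)) :
    ∫ t, g (2 * t) ∂μI = ∫ t, g t ∂μI := by
  rw [show μI = volume.restrict (Icc (-π) π) from rfl, integral_Icc_eq_integral_Ioc,
    ← intervalIntegral.integral_of_le (by linarith [Real.pi_pos]),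
    integral_Icc_eq_integral_Ioc, ← intervalIntegral.integral_of_le (by linarith [Real.pi_pos])]
  have h := intervalIntegral_comp_natCast_mul_period' hg hper (n := 2) (by norm_num)
  simpa only [Nat.cast_ofNat] using h

/-- **The twisted second factor at `|m| = 2`**:
`∫ cos² t · e^{iβ cos(2t)} dμI = π J₀(β) + πi J₁(β)` — `cos² t = ½ + ½ cos 2t`, and after the
full-period dilation `t ↦ 2t` the two pieces are Bessel's integral `2πJ₀(β)` and
`∫ cos s · e^{iβ cos s} = 2πi J₁(β)` (`integral_cos_mul_cexp_mul_cos_μI`).  Its real part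
`π J₀(β) = ½·(2πJ₀(β))` is all that enters the `τ = 0` bracket of `K_{0,2}(2 e_i)`.
[cite: DLMF, 10.9.2 and 10.6.3] -/
theorem integral_cos_sq_mul_cexp_mul_cos_two_mul_μI (β : ℝ) :
    ∫ t, ((Real.cos t ^ 2 : ℝ) : ℂ) * Complex.exp (((β * Real.cos (2 * t) : ℝ) : ℂ) * Complex.I) ∂μI
      = ((π * besselJ 0 β : ℝ) : ℂ) + ((π * besselJ 1 β : ℝ) : ℂ) * Complex.I := by
  have hsq : ∀ t : ℝ, ((Real.cos t ^ 2 : ℝ) : ℂ)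
      = (1 / 2 : ℂ) + (1 / 2 : ℂ) * ((Real.cos (2 * t) : ℝ) : ℂ) := by
    intro t; rw [Real.cos_sq t]; push_cast; ring
  simp_rw [hsq, add_mul, mul_assoc]
  have hgB : Continuous fun t : ℝ => Complex.exp (((β * Real.cos t : ℝ) : ℂ) * Complex.I) := by
    fun_prop
  have hgC : Continuous fun t : ℝ =>
      ((Real.cos t : ℝ) : ℂ) * Complex.exp (((β * Real.cos t : ℝ) : ℂ) * Complex.I) := by fun_prop
  have hperB : Function.Periodic
      (fun t : ℝ => Complex.exp (((β * Real.cos t : ℝ) : ℂ) * Complex.I)) (2 * π) := by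
    intro t; simp only [Real.cos_add_two_pi]
  have hperC : Function.Periodic (fun t : ℝ =>
      ((Real.cos t : ℝ) : ℂ) * Complex.exp (((β * Real.cos t : ℝ) : ℂ) * Complex.I)) (2 * π) := by
    intro t; simp only [Real.cos_add_two_pi]
  have hiB : Integrable (fun t : ℝ => Complex.exp (((β * Real.cos (2 * t) : ℝ) : ℂ) * Complex.I)) μI :=
    (integrable_const (1 : ℝ)).mono' (by fun_prop : Continuous fun t : ℝ =>
        Complex.exp (((β * Real.cos (2 * t) : ℝ) : ℂ) * Complex.I)).aestronglyMeasurable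
      (ae_of_all _ fun t => by rw [Complex.norm_exp_ofReal_mul_I])
  have hiC : Integrable (fun t : ℝ => ((Real.cos (2 * t) : ℝ) : ℂ)
      * Complex.exp (((β * Real.cos (2 * t) : ℝ) : ℂ) * Complex.I)) μI :=
    (integrable_const (1 : ℝ)).mono' (by fun_prop : Continuous fun t : ℝ => ((Real.cos (2 * t) : ℝ) : ℂ)
        * Complex.exp (((β * Real.cos (2 * t) : ℝ) : ℂ) * Complex.I)).aestronglyMeasurable
      (ae_of_all _ fun t => by
        rw [norm_mul, Complex.norm_exp_ofReal_mul_I, mul_one, Complex.norm_real, Real.norm_eq_abs]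
        exact Real.abs_cos_le_one _)
  rw [integral_add (hiB.const_mul _) (hiC.const_mul _), integral_const_mul, integral_const_mul]
  have hB2 : ∫ t, Complex.exp (((β * Real.cos (2 * t) : ℝ) : ℂ) * Complex.I) ∂μI
      = ((2 * π * besselJ 0 β : ℝ) : ℂ) := by
    rw [← integral_cexp_mul_cos_μI β]
    exact integral_comp_two_mul_μI hgB hperB
  have hC2 : ∫ t, ((Real.cos (2 * t) : ℝ) : ℂ)
      * Complex.exp (((β * Real.cos (2 * t) : ℝ) : ℂ) * Complex.I) ∂μI
      = ((2 * π * besselJ 1 β : ℝ) : ℂ) * Complex.I := by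
    rw [← integral_cos_mul_cexp_mul_cos_μI β]
    exact integral_comp_two_mul_μI hgC hperC
  rw [hB2, hC2]
  push_cast
  ring

end JOne

section KZeroTwoClosed

open Literature.Barriers.CriticalPhenomena
open Literature.Barriers.CriticalPhenomena.Slade2006Prop53 (μI P integral_cos_μI integral_cos_sq_μI integral_one_μI)
open Literature.Analysis.FunctionSpaces (besselJ)

/-- **`K_{0,2}(m e_i) = κ_d / (2d)` for every `|m| ≥ 3`, `d ≥ 2`**: at `τ = 0` the untwisted
bracket is `(d/2)(2π)^d` (`∫1 = 2π`, `∫cos = 0`, `∫cos² = π`) and, for `|m| ≥ 3`, the twisted one is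
`(d/2)(2πJ₀(β))^d` (`B = 2πJ₀(β)`, `C₁ = 0`, `C₂ = ½B` by shift-averaging), so the inner integral of
`K_{0,2}(m e_i)` is `(2π)^d (1 - J₀(β)^d)/(2d)` — i.e. `κ_d`'s integrand over `2d`
(`srwK_zero_zero_single_eq_integral_besselJ`).
[cite: FitznerVanDerHofstad2016NoBLE, (3.36) p. 1071; §5.1.1 (5.2)–(5.4)] -/
theorem srwK_zero_two_single_eq_kappa_div_of_three_le (hd : 2 ≤ d) (i : Fin d) {m : ℤ}
    (hm : 3 ≤ |m|) :
    srwK d 0 2 (Pi.single i m) = srwK d 0 0 (Pi.single i 1) / (2 * d) := by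
  have hm0 : m ≠ 0 := by rintro rfl; simp at hm
  have hm2 : 2 ≤ |m| := le_trans (by norm_num) hm
  obtain ⟨e, rfl⟩ : ∃ e, d = e + 2 := ⟨d - 2, by omega⟩
  rw [srwK_zero_two_single_eq_integral hd i m, srwK_zero_zero_single_eq_integral_besselJ i]
  have hU0 : ∫ t, ((Real.cos t ^ 2 : ℝ) : ℂ) ∂μI = (π : ℂ) := by
    rw [integral_complex_ofReal, integral_cos_sq_μI]
  have hU1 : ∫ t, ((Real.cos t : ℝ) : ℂ) ∂μI = 0 := by
    rw [integral_complex_ofReal, integral_cos_μI, Complex.ofReal_zero]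
  have hUB : ∫ _t, (1 : ℂ) ∂μI = ((2 * π : ℝ) : ℂ) := by
    rw [← integral_one_μI, ← integral_complex_ofReal]; simp
  rw [mul_div_assoc, ← integral_div]
  congr 1
  refine setIntegral_congr_fun measurableSet_Ioi (fun β hβ => ?_)
  have hβ0 : (β : ℝ) ≠ 0 := ne_of_gt hβ
  rw [integral_cexp_mul_cos_int_mul_μI β hm0, integral_cos_mul_cexp_mul_cos_int_mul_μI_eq_zero β hm2,
    integral_cos_sq_mul_cexp_mul_cos_int_mul_μI β hm, integral_cexp_mul_cos_int_mul_μI β hm0,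
    hU0, hU1, hUB]
  rw [show e + 2 - 1 = e + 1 by omega, show e + 2 - 2 = e by omega]
  simp only [zero_pow two_ne_zero, mul_zero, zero_mul, add_zero]
  have h1 : (((e + 2 : ℕ) : ℂ) * (π : ℂ) * (((2 * π : ℝ) : ℂ)) ^ (e + 1))
      = (((e + 2 : ℕ) * π * (2 * π) ^ (e + 1) : ℝ) : ℂ) := by push_cast; ring
  have h2 : (((e + 2 : ℕ) : ℂ) * ((1 / 2 : ℂ) * (((2 * π * besselJ 0 β : ℝ) : ℂ)))
        * (((2 * π * besselJ 0 β : ℝ) : ℂ)) ^ (e + 1))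
      = (((e + 2 : ℕ) * (1 / 2) * (2 * π * besselJ 0 β) ^ (e + 2) : ℝ) : ℂ) := by push_cast; ring
  rw [h1, h2, Complex.ofReal_re, Complex.ofReal_re]
  push_cast
  field_simp
  ring

/-- **`K_{0,2}(±2 e_i) = κ_d / (2d)`** as well: for `|m| = 2` the twisted first factor still
vanishes and the twisted second factor is `πJ₀(β) + πiJ₁(β)`, whose real part `πJ₀(β) = ½B`
is all that survives `Complex.re`. [cite: FitznerVanDerHofstad2016NoBLE, (3.36) p. 1071; §5.1.1 (5.2)–(5.4)] -/
theorem srwK_zero_two_single_eq_kappa_div_of_abs_eq_two (hd : 2 ≤ d) (i : Fin d) {m : ℤ}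
    (hm : |m| = 2) :
    srwK d 0 2 (Pi.single i m) = srwK d 0 0 (Pi.single i 1) / (2 * d) := by
  have hcos : ∀ t : ℝ, Real.cos (m * t) = Real.cos (2 * t) := by
    intro t
    rcases (abs_eq (by norm_num : (0 : ℤ) ≤ 2)).1 hm with rfl | rfl
    · norm_num
    · push_cast
      rw [neg_mul, Real.cos_neg]
  have hm0 : m ≠ 0 := by rintro rfl; simp at hm
  have hm2 : 2 ≤ |m| := hm.ge
  obtain ⟨e, rfl⟩ : ∃ e, d = e + 2 := ⟨d - 2, by omega⟩
  rw [srwK_zero_two_single_eq_integral hd i m, srwK_zero_zero_single_eq_integral_besselJ i]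
  have hU0 : ∫ t, ((Real.cos t ^ 2 : ℝ) : ℂ) ∂μI = (π : ℂ) := by
    rw [integral_complex_ofReal, integral_cos_sq_μI]
  have hU1 : ∫ t, ((Real.cos t : ℝ) : ℂ) ∂μI = 0 := by
    rw [integral_complex_ofReal, integral_cos_μI, Complex.ofReal_zero]
  have hUB : ∫ _t, (1 : ℂ) ∂μI = ((2 * π : ℝ) : ℂ) := by
    rw [← integral_one_μI, ← integral_complex_ofReal]; simp
  rw [mul_div_assoc, ← integral_div]
  congr 1
  refine setIntegral_congr_fun measurableSet_Ioi (fun β hβ => ?_)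
  have hβ0 : (β : ℝ) ≠ 0 := ne_of_gt hβ
  rw [integral_cexp_mul_cos_int_mul_μI β hm0, integral_cos_mul_cexp_mul_cos_int_mul_μI_eq_zero β hm2]
  simp_rw [hcos]
  rw [integral_cos_sq_mul_cexp_mul_cos_two_mul_μI β, hU0, hU1, hUB]
  rw [show e + 2 - 1 = e + 1 by omega, show e + 2 - 2 = e by omega]
  simp only [zero_pow two_ne_zero, mul_zero, zero_mul, add_zero]
  have h1 : (((e + 2 : ℕ) : ℂ) * (π : ℂ) * (((2 * π : ℝ) : ℂ)) ^ (e + 1))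
      = (((e + 2 : ℕ) * π * (2 * π) ^ (e + 1) : ℝ) : ℂ) := by push_cast; ring
  have h2 : (((e + 2 : ℕ) : ℂ) * ((((π * besselJ 0 β : ℝ) : ℂ)) + (((π * besselJ 1 β : ℝ) : ℂ)) * Complex.I)
        * (((2 * π * besselJ 0 β : ℝ) : ℂ)) ^ (e + 1))
      = (((e + 2 : ℕ) * (1 / 2) * (2 * π * besselJ 0 β) ^ (e + 2) : ℝ) : ℂ)
        + (((e + 2 : ℕ) * (π * besselJ 1 β) * (2 * π * besselJ 0 β) ^ (e + 1) : ℝ) : ℂ)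
          * Complex.I := by push_cast; ring
  rw [h1, h2]
  simp only [Complex.add_re, Complex.ofReal_re, Complex.mul_I_re, Complex.ofReal_im, neg_zero,
    add_zero]
  push_cast
  field_simp
  ring

/-- **`K_{0,2}(m e_i) = K_{0,0}(e_i) / (2d) = κ_d / (2d)` for every `d ≥ 2` and every `|m| ≥ 2`**
(`srwK_zero_two_single_eq_kappa_div_of_three_le` and `…_of_abs_eq_two`).  Equivalently
`∫ D̂(k)² |D̂^{(m e_i)}(k)| dk/(2π)^d = κ_d/(2d)`: the off-diagonal terms of `D̂²` die by
shift-averaging, the diagonal ones contribute `½κ_d/d` each by dilation invariance.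
[cite: FitznerVanDerHofstad2016NoBLE, (3.36) p. 1071; §5.1.1 (5.2)–(5.4)] -/
theorem srwK_zero_two_single_eq_kappa_div (hd : 2 ≤ d) (i : Fin d) {m : ℤ} (hm : 2 ≤ |m|) :
    srwK d 0 2 (Pi.single i m) = srwK d 0 0 (Pi.single i 1) / (2 * d) := by
  rcases hm.eq_or_lt with h | h
  · exact srwK_zero_two_single_eq_kappa_div_of_abs_eq_two hd i h.symm
  · exact srwK_zero_two_single_eq_kappa_div_of_three_le hd i (by omega)

/-- `∫ sin² t · e^{iβ cos t} dμI = 2π J₁(β)/β` for `β ≠ 0` (integration by parts on the full period: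
`sin t · (sin t e^{iβ cos t}) = sin t · d/dt[-e^{iβ cos t}/(iβ)]`, boundary terms `sin(±π) = 0`, and
`integral_cos_mul_cexp_mul_cos_μI`). [cite: DLMF, 10.9.2 and 10.6.3] -/
theorem integral_sin_sq_mul_cexp_mul_cos_μI (β : ℝ) (hβ : β ≠ 0) :
    ∫ t, ((Real.sin t ^ 2 : ℝ) : ℂ) * Complex.exp (((β * Real.cos t : ℝ) : ℂ) * Complex.I) ∂μI
      = ((2 * π * besselJ 1 β / β : ℝ) : ℂ) := by
  have hIβ : Complex.I * (β : ℂ) ≠ 0 := mul_ne_zero Complex.I_ne_zero (by exact_mod_cast hβ)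
  -- u = sin, v = -e^{iβ cos t}/(iβ)
  set u : ℝ → ℂ := fun t => ((Real.sin t : ℝ) : ℂ) with hu
  set u' : ℝ → ℂ := fun t => ((Real.cos t : ℝ) : ℂ) with hu'
  set v : ℝ → ℂ := fun t => -Complex.exp (((β * Real.cos t : ℝ) : ℂ) * Complex.I) / (Complex.I * β)
    with hv
  set v' : ℝ → ℂ := fun t => ((Real.sin t : ℝ) : ℂ) * Complex.exp (((β * Real.cos t : ℝ) : ℂ) * Complex.I)
    with hv'
  have hdu : ∀ t, HasDerivAt u (u' t) t := fun t => by
    simpa [hu, hu'] using (Real.hasDerivAt_sin t).ofReal_comp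
  have hdv : ∀ t, HasDerivAt v (v' t) t := fun t => by
    have h1 : HasDerivAt (fun t : ℝ => ((β * Real.cos t : ℝ) : ℂ) * Complex.I)
        (((β * -Real.sin t : ℝ) : ℂ) * Complex.I) t :=
      ((Real.hasDerivAt_cos t).const_mul β).ofReal_comp.mul_const Complex.I
    have h2 := (h1.cexp.div_const (Complex.I * β)).neg
    have hv2 : v = -fun x => Complex.exp (((β * Real.cos x : ℝ) : ℂ) * Complex.I) / (Complex.I * β) := by
      funext x; simp only [hv, Pi.neg_apply, neg_div]
    rw [hv2]
    refine h2.congr_deriv ?_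
    simp only [hv']
    have hI : Complex.I ≠ 0 := Complex.I_ne_zero
    have hβ' : (β : ℂ) ≠ 0 := by exact_mod_cast hβ
    field_simp
    push_cast
    ring_nf
  have hparts := intervalIntegral.integral_mul_deriv_eq_deriv_mul (a := -π) (b := π)
    (fun t _ => hdu t) (fun t _ => hdv t)
    ((by fun_prop : Continuous u').intervalIntegrable _ _)
    ((by fun_prop : Continuous v').intervalIntegrable _ _)
  -- boundary terms vanish: sin(±π) = 0
  have hb : u π * v π - u (-π) * v (-π) = 0 := by simp [hu]
  rw [hb, zero_sub] at hparts
  -- convert μI integrals to interval integrals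
  have hI : ∀ f : ℝ → ℂ, ∫ t, f t ∂μI = ∫ t in (-π)..π, f t := fun f => by
    rw [show μI = volume.restrict (Icc (-π) π) from rfl, integral_Icc_eq_integral_Ioc,
      ← intervalIntegral.integral_of_le (by linarith [Real.pi_pos])]
  have hsq : (fun t : ℝ => ((Real.sin t ^ 2 : ℝ) : ℂ) * Complex.exp (((β * Real.cos t : ℝ) : ℂ) * Complex.I))
      = fun t => u t * v' t := by
    funext t; simp only [hu, hv']; push_cast; ring
  rw [hsq, hI, hparts]
  have hJ1 := integral_cos_mul_cexp_mul_cos_μI β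
  rw [hI] at hJ1
  have huv : (fun t : ℝ => u' t * v t) = fun t => (-1 / (Complex.I * β)) *
      (((Real.cos t : ℝ) : ℂ) * Complex.exp (((β * Real.cos t : ℝ) : ℂ) * Complex.I)) := by
    funext t; simp only [hu', hv]; field_simp
  rw [huv, intervalIntegral.integral_const_mul, hJ1]
  have hI : Complex.I ≠ 0 := Complex.I_ne_zero
  have hβ' : (β : ℂ) ≠ 0 := by exact_mod_cast hβ
  push_cast
  field_simp


/-- **The twisted second factor at `|m| = 1`**:
`C₂(0,β)|_{m=1} = ∫ cos² t · e^{iβ cos t} dμI = 2πJ₀(β) - 2πJ₁(β)/β` for `β ≠ 0` (`cos² = 1 - sin²`).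
[cite: DLMF, 10.9.2 and 10.6.3] -/
theorem integral_cos_sq_mul_cexp_mul_cos_μI (β : ℝ) (hβ : β ≠ 0) :
    ∫ t, ((Real.cos t ^ 2 : ℝ) : ℂ) * Complex.exp (((β * Real.cos t : ℝ) : ℂ) * Complex.I) ∂μI
      = ((2 * π * besselJ 0 β : ℝ) : ℂ) - ((2 * π * besselJ 1 β / β : ℝ) : ℂ) := by
  have hcs : ∀ t : ℝ, ((Real.cos t ^ 2 : ℝ) : ℂ) = 1 - ((Real.sin t ^ 2 : ℝ) : ℂ) := by
    intro t; rw [Real.cos_sq' t]; push_cast; ring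
  simp_rw [hcs, sub_mul, one_mul]
  have hiB : Integrable (fun t : ℝ => Complex.exp (((β * Real.cos t : ℝ) : ℂ) * Complex.I)) μI :=
    (integrable_const (1 : ℝ)).mono' (by fun_prop : Continuous fun t : ℝ =>
        Complex.exp (((β * Real.cos t : ℝ) : ℂ) * Complex.I)).aestronglyMeasurable
      (ae_of_all _ fun t => by rw [Complex.norm_exp_ofReal_mul_I])
  have hiS : Integrable (fun t : ℝ => ((Real.sin t ^ 2 : ℝ) : ℂ)
      * Complex.exp (((β * Real.cos t : ℝ) : ℂ) * Complex.I)) μI :=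
    (integrable_const (1 : ℝ)).mono' (by fun_prop : Continuous fun t : ℝ => ((Real.sin t ^ 2 : ℝ) : ℂ)
        * Complex.exp (((β * Real.cos t : ℝ) : ℂ) * Complex.I)).aestronglyMeasurable
      (ae_of_all _ fun t => by
        rw [norm_mul, Complex.norm_exp_ofReal_mul_I, mul_one, Complex.norm_real, Real.norm_eq_abs,
          abs_of_nonneg (sq_nonneg _)]
        nlinarith [Real.sin_sq_add_cos_sq t, sq_nonneg (Real.cos t)])
  rw [integral_sub hiB hiS, integral_cexp_mul_cos_μI β, integral_sin_sq_mul_cexp_mul_cos_μI β hβ]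

/-- **`K_{0,2}(e_i) = ∫ D̂² |D̂| dk/(2π)^d` in closed single-integral Bessel form** (the `|m| = 1` case,
`D̂^{(e_i)} = D̂`): `K_{0,2}(e_i) = (2/(πd)) ∫₀^∞ β⁻² · (1/d)·[½ - J₀(β)^d + J₁(β)J₀(β)^{d-1}/β
+ (d-1) J₁(β)² J₀(β)^{d-2}] dβ` for every `d ≥ 2` — twisted factors `B = 2πJ₀`, `C₁ = 2πiJ₁`,
`C₂ = 2πJ₀ - 2πJ₁/β`. [cite: FitznerVanDerHofstad2016NoBLE, (3.36) p. 1071; §5.1.1 (5.2)–(5.4)] -/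
theorem srwK_zero_two_single_one_eq_integral_besselJ (hd : 2 ≤ d) (i : Fin d) :
    srwK d 0 2 (Pi.single i 1) = 2 / (π * d) * ∫ β in Ioi (0:ℝ),
      (1 / (d : ℝ) * (1 / 2 - besselJ 0 β ^ d + besselJ 1 β * besselJ 0 β ^ (d - 1) / β
        + ((d : ℝ) - 1) * besselJ 1 β ^ 2 * besselJ 0 β ^ (d - 2))) / β ^ 2 := by
  obtain ⟨e, rfl⟩ : ∃ e, d = e + 2 := ⟨d - 2, by omega⟩
  rw [srwK_zero_two_single_eq_integral hd i 1]
  have hU0 : ∫ t, ((Real.cos t ^ 2 : ℝ) : ℂ) ∂μI = (π : ℂ) := by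
    rw [integral_complex_ofReal, integral_cos_sq_μI]
  have hU1 : ∫ t, ((Real.cos t : ℝ) : ℂ) ∂μI = 0 := by
    rw [integral_complex_ofReal, integral_cos_μI, Complex.ofReal_zero]
  have hUB : ∫ _t, (1 : ℂ) ∂μI = ((2 * π : ℝ) : ℂ) := by
    rw [← integral_one_μI, ← integral_complex_ofReal]; simp
  congr 1
  refine setIntegral_congr_fun measurableSet_Ioi (fun β hβ => ?_)
  have hβ0 : (β : ℝ) ≠ 0 := ne_of_gt hβ
  simp only [Int.cast_one, one_mul]
  rw [integral_cexp_mul_cos_μI β, integral_cos_mul_cexp_mul_cos_μI β,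
    integral_cos_sq_mul_cexp_mul_cos_μI β hβ0, hU0, hU1, hUB]
  rw [show e + 2 - 1 = e + 1 by omega, show e + 2 - 2 = e by omega]
  simp only [zero_pow two_ne_zero, mul_zero, zero_mul, add_zero]
  have h1 : (((e + 2 : ℕ) : ℂ) * (π : ℂ) * (((2 * π : ℝ) : ℂ)) ^ (e + 1))
      = (((e + 2 : ℕ) * π * (2 * π) ^ (e + 1) : ℝ) : ℂ) := by push_cast; ring
  have hI2 : (((2 * π * besselJ 1 β : ℝ) : ℂ) * Complex.I) ^ 2
      = -(((2 * π * besselJ 1 β) ^ 2 : ℝ) : ℂ) := by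
    rw [mul_pow, Complex.I_sq]; push_cast; ring
  have h2 : (((e + 2 : ℕ) : ℂ) * ((((2 * π * besselJ 0 β : ℝ) : ℂ)) - (((2 * π * besselJ 1 β / β : ℝ) : ℂ)))
        * (((2 * π * besselJ 0 β : ℝ) : ℂ)) ^ (e + 1)
        + ((e + 2 : ℕ) : ℂ) * (((e + 2 : ℕ) : ℂ) - 1) * ((((2 * π * besselJ 1 β : ℝ) : ℂ) * Complex.I)) ^ 2
          * (((2 * π * besselJ 0 β : ℝ) : ℂ)) ^ e)
      = (((e + 2 : ℕ) * ((2 * π * besselJ 0 β) - 2 * π * besselJ 1 β / β) * (2 * π * besselJ 0 β) ^ (e + 1)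
          - (e + 2 : ℕ) * ((e + 2 : ℕ) - 1) * (2 * π * besselJ 1 β) ^ 2 * (2 * π * besselJ 0 β) ^ e : ℝ) : ℂ) := by
    rw [hI2]; push_cast; ring
  rw [h1, h2, Complex.ofReal_re, Complex.ofReal_re]
  push_cast
  field_simp
  ring

end KZeroTwoClosed

end Literature.Probability.FitznerVanDerHofstad2017

end
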